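import Summits.ResolutionOfSingularities.ResolutionOfSingularities.Theorems.WeightedInvariantIota3RowADominanceSteps

/-!
# (F-3d) ROW A DOMINANCE: `(J-can)` for the germs `f = y^p + Λ v^d + x^M` — the second member of any
# competing reaching flag weighs at least `r₂/q` on `v`  [OURS · L1 W4.3]

Kernel form of the first rung of RE-ENTRY OBJECT #1 of chain w43 (the DOM word at level ≤ 3, door crux
`stmt-ResolutionOfSingularities-19897`): res-D-brk-1's Frobenius-class argument (O70B-JCAN-PLAN §7, «ROW A»,
hand proof OURS) in the power-series model `S = K⟦X₀, X₁, X₂⟧`, `K` a field of characteristic `p`.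

THE STATEMENT (`rowA_secondMember_mem`).  Let `f = y^p + Λ v^d + X₀^M` with `p ∤ d`, `p < d`, `Λ ≠ 0`,
`N = p r₁ = d r₂ = M q`, `0 < q < r₂`, where `(X₀, v, y)` is ANY regular system of parameters of `S`
sharing `X₀` with the coordinates (`(X₀, v, y) = 𝔪`).  If `f` reaches level `N` in res-D-brk-1's two-flag
filtration of the COORDINATE flag `(X₂; X₁)` with triple `(q; r₁, r₂)`, then `v` lies in that filtration
at level `r₂` — i.e. the competing flag weighs `v` at least `r₂/q`: the second members DOMINATE each other.
(Equivalent, by the formal coordinate change `(X₀, X₁, X₂) ↦ (X₀, v', y')`, to the same statement for the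
germ `X₂^p + Λ X₁^d + X₀^M` and an arbitrary competing flag `(y'; v')` with `(X₀, v', y') = 𝔪`; that
transport is not part of this file.)

THE PROOF (`rowA_core`, on weighted orders `W = W_{(q, r₂, r₁)}` via the bridge
`RowA.mem_flagContactFiltration_X_iff`).  Suppose `W(v) = a < r₂`.  Only pure `X₀`-powers weigh `< r₂`, so
the initial form of `v` is a single monomial `μ X₀^{m₀}`, `a = q m₀` (`initialMonomial_of_weightedOrder_lt`).
Frobenius on `y^p` and `W(f) ≥ N > p r₂` kill the `X₁`-coefficient of `y` (`coeff_single_one_eq_zero_of_reach`).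
(α) `p ∤ m₀`: the coefficient of `X₀^{d m₀}` in `f` is `Λ μ^d ≠ 0` (`y^p` has no such exponent, `M ≠ d m₀`)
at weight `d a < N` — contradiction (`coeff_single_pow_ne_zero`).  (β) `p ∣ m₀`: split `v = G + R` into
its `p`-class-`0` component `G = v_0` (`W(G) = a`) and the rest `R` (`W(R) = ρ > a`, file D); the
non-class-`0` part `Q = v^d − (v^d)_0 = Σ_{k ≥ 1} C(d,k) (R^k − (R^k)_0) G^{d−k}` of `v^d` has `W(Q) ≥ N`
(`W(h − h_0) ≥ W(h)`), and its `k = 1` term `d·R·G^{d−1}` has exact order `ρ + (d−1)a`, strictly below the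
`k ≥ 2` terms; hence `ρ + (d−1)a ≥ N = d r₂`, impossible for `ρ ≤ r₂`.  So `ρ > r₂`: `R`, `G` (class!) and
therefore `v` have no `X₁`-term — but then `X₁ ∉ (X₀, v, y)` (`RowA.false_of_frame`), contradiction.

[OURS · L1 W4.3] replaces the role of the inseparable Tschirnhausen tower of the manuscript's `(J-can)`
discussion for row-A germs; NOT a statement of the manuscript; AI-produced, gate-checked, weaker than
expert review.
-/

set_option linter.dupNamespace false

namespace Summit.ResolutionOfSingularities.ResolutionOfSingularities.Theorems.LocalEngine.Iota3.RowA

open MvPowerSeries IsLocalRing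
open Summit.ResolutionOfSingularities.ResolutionOfSingularities.Theorems.LocalEngine.Iota3.PClass
open Summit.ResolutionOfSingularities.ResolutionOfSingularities.Cruxes.HypersurfaceCentreConstruction.LocalEngine.Iota3

variable {K : Type*} [Field K]

/-! ## The core: `W(v) ≥ r₂` -/

/-- **ROW A, CORE FORM** (weighted orders for the weights `(q, r₂, r₁)` on `(X₀, X₁, X₂)`): for
`f = y^p + Λ v^d + X₀^M` as in the module docstring with `v(0) = y(0) = 0` and `X₁ ∈ (X₀, v, y)`,
`W(f) ≥ N` forces `W(v) ≥ r₂`. -/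
theorem rowA_core (p : ℕ) [Fact p.Prime] [CharP K p] {d M q r₁ r₂ N : ℕ} (hpd : ¬ p ∣ d) (hlt : p < d)
    (hN₁ : p * r₁ = N) (hN₂ : d * r₂ = N) (hN₃ : M * q = N) (hq : 0 < q) (hqr : q < r₂) {Λ : K} (hΛ : Λ ≠ 0)
    {y v : MvPowerSeries (Fin 3) K} (hv0 : constantCoeff v = 0) (hy0 : constantCoeff y = 0)
    (hX1 : (X 1 : MvPowerSeries (Fin 3) K) ∈ Ideal.span {(X 0 : MvPowerSeries (Fin 3) K), v, y})
    (hreach : (N : ℕ∞) ≤ (y ^ p + C Λ * v ^ d + X 0 ^ M).weightedOrder ![q, r₂, r₁]) :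
    (r₂ : ℕ∞) ≤ v.weightedOrder ![q, r₂, r₁] := by
  classical
  -- numerics
  have hp : p.Prime := Fact.out
  have hp2 : 2 ≤ p := hp.two_le
  have hd2 : 2 ≤ d := by omega
  have hr₂ : 0 < r₂ := by omega
  have hr₂r₁ : r₂ < r₁ := by
    by_contra h
    push Not at h
    have h1 : p * r₁ ≤ p * r₂ := Nat.mul_le_mul_left _ h
    have h2 : p * r₂ < d * r₂ := Nat.mul_lt_mul_of_pos_right hlt hr₂
    omega
  have hpr₂N : p * r₂ < N := by
    have := Nat.mul_lt_mul_of_pos_left hr₂r₁ hp.pos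
    omega
  haveI : NeZero p := ⟨hp.ne_zero⟩
  haveI : Fact (1 < p) := ⟨hp.one_lt⟩
  by_contra hvlt
  push Not at hvlt
  -- STEP 1: the initial form of `v` is `μ X₀^{m₀}`, `a = q m₀ < r₂`
  obtain ⟨m₀, hcm, hWv, ham, hini⟩ := initialMonomial_of_weightedOrder_lt hq hr₂r₁.le hvlt
  have hm₀ : 0 < m₀ := by
    by_contra h0
    have h0 : m₀ = 0 := by omega
    rw [h0, Finsupp.single_zero, coeff_zero_eq_constantCoeff_apply, hv0] at hcm
    exact hcm rfl
  -- STEP 2: `y` has no `X₁`-term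
  have hy1 : coeff (Finsupp.single 1 1) y = 0 := coeff_single_one_eq_zero_of_reach p hlt hpr₂N hv0 hreach
  by_cases hpm : p ∣ m₀
  · /- CASE (β): `p ∣ m₀`.  `G = v_0`, `R = v - v_0`. -/
    set G := pClassComponent p 0 v with hGdef
    set R := v - pClassComponent p 0 v with hRdef
    have hclass : exponentClass p (Finsupp.single (0 : Fin 3) m₀) = 0 := by
      rw [exponentClass_eq_zero_iff]
      intro i
      rw [Finsupp.single_apply]
      split_ifs
      · exact hpm
      · exact dvd_zero p
    have hWG : G.weightedOrder ![q, r₂, r₁] = ((q * m₀ : ℕ) : ℕ∞) := by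
      have h := weightedOrder_pClassComponent_of_initialMonomial (![q, r₂, r₁]) p hcm hini
      rw [hclass, weight_single_zero] at h
      exact h
    have hWR : ((q * m₀ : ℕ) : ℕ∞) < R.weightedOrder ![q, r₂, r₁] := by
      have h := weight_lt_weightedOrder_sub_pClassComponent_of_initialMonomial (![q, r₂, r₁]) p hini
      rw [hclass, weight_single_zero] at h
      exact h
    have hG0 : pClassComponent p 0 G = G := by
      rw [hGdef, pClassComponent_pClassComponent, if_pos rfl]
    have hR0 : pClassComponent p 0 R = 0 := pClassComponent_sub_pClassComponent_self p 0 v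
    -- the `X₁`-coefficient of `G` vanishes (class!), that of `R` because `W(R) > r₂`:
    have hG1 : coeff (Finsupp.single 1 1) G = 0 := by
      refine coeff_pClassComponent_of_ne (fun h => ?_) v
      have h1 := congr_fun h 1
      rw [exponentClass_apply, Finsupp.single_eq_same, Nat.cast_one, Pi.zero_apply] at h1
      exact one_ne_zero h1
    have hR1 : coeff (Finsupp.single 1 1) R = 0 := by
      refine coeff_eq_zero_of_lt_weightedOrder (![q, r₂, r₁]) ?_
      rw [weight_single_one]
      -- suppose `W(R) ≤ r₂`; then the `k = 1` term of the binomial expansion is too light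
      by_contra hρ
      push Not at hρ
      have hRne : R.weightedOrder ![q, r₂, r₁] ≠ ⊤ := ne_top_of_le_ne_top (ENat.coe_ne_top r₂) hρ
      obtain ⟨ρ, hρeq⟩ : ∃ ρ : ℕ, R.weightedOrder ![q, r₂, r₁] = ρ := ⟨_, (ENat.coe_toNat hRne).symm⟩
      rw [hρeq, Nat.cast_le] at hρ
      rw [hρeq, Nat.cast_lt] at hWR
      -- `h = y^p + Λ v^d` has `W(h) ≥ N`
      have hWh : (N : ℕ∞) ≤ (y ^ p + C Λ * v ^ d).weightedOrder ![q, r₂, r₁] := by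
        have hX : (N : ℕ∞) ≤ (-(X 0 ^ M : MvPowerSeries (Fin 3) K)).weightedOrder ![q, r₂, r₁] := by
          rw [weightedOrder_neg, X_pow_eq, weightedOrder_monomial_of_ne_zero _ one_ne_zero, weight_single_zero,
            mul_comm, hN₃]
        have h := min_weightedOrder_le_add (w := ![q, r₂, r₁]) (f := y ^ p + C Λ * v ^ d + X 0 ^ M)
          (g := -(X 0 ^ M))
        rw [add_neg_cancel_right] at h
        exact le_trans (le_min hreach hX) h
      -- the non-class-0 part `Q` of `v^d` has `W(Q) ≥ N` (coefficientwise)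
      set Q := v ^ d - pClassComponent p 0 (v ^ d) with hQdef
      have hhQ : y ^ p + C Λ * v ^ d - pClassComponent p 0 (y ^ p + C Λ * v ^ d) = C Λ * Q := by
        rw [pClassComponent_add, pClassComponent_zero_pow_expChar, pClassComponent_C_mul, hQdef]
        ring
      have hQ : ∀ e : Fin 3 →₀ ℕ, Finsupp.weight ![q, r₂, r₁] e < N → coeff e Q = 0 := by
        intro e he
        have h1 : coeff e (C Λ * Q) = 0 := by
          rw [← hhQ]
          refine coeff_eq_zero_of_lt_weightedOrder _ (lt_of_lt_of_le ?_
            (hWh.trans (le_weightedOrder_sub_pClassComponent _ p 0 _)))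
          exact_mod_cast he
        rw [coeff_C_mul] at h1
        exact (mul_eq_zero.mp h1).resolve_left hΛ
      -- binomial expansion of `v^d = (R + G)^d` by classes
      have hGpow : ∀ j, pClassComponent p 0 (G ^ j) = G ^ j := pClassComponent_zero_pow_of_pure p hG0
      have hP : ∀ k, pClassComponent p 0 (G ^ (d - k) * (d.choose k : MvPowerSeries (Fin 3) K)) =
          G ^ (d - k) * (d.choose k : MvPowerSeries (Fin 3) K) := fun k => by
        rw [← map_natCast (C : K →+* MvPowerSeries (Fin 3) K), mul_comm, pClassComponent_C_mul, hGpow]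
      have hvRG : v = R + G := by rw [hRdef, hGdef, sub_add_cancel]
      have hQsum : Q = ∑ k ∈ Finset.range (d + 1),
          (R ^ k - pClassComponent p 0 (R ^ k)) * (G ^ (d - k) * (d.choose k : MvPowerSeries (Fin 3) K)) := by
        rw [hQdef, hvRG, add_pow, pClassComponent_sum, ← Finset.sum_sub_distrib]
        refine Finset.sum_congr rfl fun k _ => ?_
        rw [mul_assoc, pClassComponent_mul_of_right_pure_zero (hP k), sub_mul]
      -- orders of the terms
      have hWd : ((d : ℕ) : MvPowerSeries (Fin 3) K).weightedOrder ![q, r₂, r₁] = 0 := by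
        rw [← map_natCast (C : K →+* MvPowerSeries (Fin 3) K)]
        exact weightedOrder_C _ ((CharP.cast_eq_zero_iff K p d).not.mpr hpd)
      have hT1 : ((R ^ 1 - pClassComponent p 0 (R ^ 1)) * (G ^ (d - 1) * (d.choose 1 : MvPowerSeries (Fin 3) K))).weightedOrder
          ![q, r₂, r₁] = ((ρ + (d - 1) * (q * m₀) : ℕ) : ℕ∞) := by
        rw [pow_one, hR0, sub_zero, Nat.choose_one_right, weightedOrder_mul, weightedOrder_mul, weightedOrder_pow,
          hWG, hWd, hρeq, add_zero, nsmul_eq_mul]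
        push_cast
        ring
      have hTk : ∀ k ∈ Finset.range (d + 1), 2 ≤ k →
          (((ρ + (d - 1) * (q * m₀) : ℕ) : ℕ∞)) <
            ((R ^ k - pClassComponent p 0 (R ^ k)) * (G ^ (d - k) * (d.choose k : MvPowerSeries (Fin 3) K))).weightedOrder
              ![q, r₂, r₁] := by
        intro k hk hk2
        rw [Finset.mem_range] at hk
        have hnum := lt_binomial_weight hk2 (Nat.lt_succ_iff.mp hk) hWR
        refine lt_of_lt_of_le (b := (((k * ρ + (d - k) * (q * m₀) : ℕ) : ℕ∞))) (by exact_mod_cast hnum) ?_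
        refine le_trans ?_ (le_weightedOrder_mul _)
        have h1 : (((k * ρ : ℕ)) : ℕ∞) ≤ (R ^ k - pClassComponent p 0 (R ^ k)).weightedOrder ![q, r₂, r₁] := by
          refine le_trans ?_ (le_weightedOrder_sub_pClassComponent _ p 0 _)
          rw [weightedOrder_pow, hρeq, nsmul_eq_mul, Nat.cast_mul]
        have h2 : ((((d - k) * (q * m₀) : ℕ)) : ℕ∞) ≤
            (G ^ (d - k) * (d.choose k : MvPowerSeries (Fin 3) K)).weightedOrder ![q, r₂, r₁] := by
          refine le_trans ?_ (le_weightedOrder_mul _)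
          rw [weightedOrder_pow, hWG, nsmul_eq_mul, Nat.cast_mul]
          exact le_self_add
        push_cast at h1 h2 ⊢
        exact add_le_add h1 h2
      -- the `k = 1` term has a nonzero coefficient of weight `ρ + (d-1)a`, invisible to the other terms
      have hfin : ((((R ^ 1 - pClassComponent p 0 (R ^ 1)) * (G ^ (d - 1) * (d.choose 1 : MvPowerSeries (Fin 3) K))).weightedOrder
          ![q, r₂, r₁]).toNat : ℕ∞) =
          ((R ^ 1 - pClassComponent p 0 (R ^ 1)) * (G ^ (d - 1) * (d.choose 1 : MvPowerSeries (Fin 3) K))).weightedOrder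
            ![q, r₂, r₁] := by
        rw [hT1]; rfl
      obtain ⟨e, hce, hwe⟩ := exists_coeff_ne_zero_and_weightedOrder _ hfin
      rw [hT1, Nat.cast_inj] at hwe
      have hcoeffQ : coeff e Q = coeff e ((R ^ 1 - pClassComponent p 0 (R ^ 1)) *
          (G ^ (d - 1) * (d.choose 1 : MvPowerSeries (Fin 3) K))) := by
        rw [hQsum, map_sum]
        refine Finset.sum_eq_single 1 (fun k hk hk1 => ?_) (fun h => absurd (Finset.mem_range.mpr (by omega)) h)
        rcases Nat.lt_or_ge k 2 with hk2 | hk2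
        · -- k = 0
          have hk0 : k = 0 := by omega
          have h1 : pClassComponent p 0 (1 : MvPowerSeries (Fin 3) K) = 1 := by
            have h := hGpow 0
            rwa [pow_zero] at h
          rw [hk0, pow_zero, h1, sub_self, zero_mul, map_zero]
        · refine coeff_eq_zero_of_lt_weightedOrder (![q, r₂, r₁]) ?_
          rw [hwe]
          exact hTk k hk hk2
      have hlight : Finsupp.weight ![q, r₂, r₁] e < N := by
        rw [hwe, ← hN₂]
        have h1 : (d - 1) * (q * m₀) ≤ (d - 1) * (r₂ - 1) := Nat.mul_le_mul_left _ (by omega)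
        have h2 : ρ + (d - 1) * (r₂ - 1) < d * r₂ := by
          obtain ⟨j, rfl⟩ := Nat.exists_eq_add_of_le hd2
          obtain ⟨i, rfl⟩ := Nat.exists_eq_add_of_le (Nat.one_le_of_lt hqr)
          rw [show 2 + j - 1 = j + 1 by omega, show 1 + i - 1 = i by omega]
          nlinarith
        omega
      exact absurd (hcoeffQ ▸ hQ e hlight) hce
    have hv1 : coeff (Finsupp.single 1 1) v = 0 := by
      rw [show v = R + G from (sub_add_cancel v _).symm, map_add, hR1, hG1, add_zero]
    exact false_of_frame hX1 hv0 hy0 hv1 hy1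
  · /- CASE (α): `p ∤ m₀`.  The coefficient of `X₀^{d m₀}` in `f` is `Λ μ^d ≠ 0`, of weight `d a < N`. -/
    have hdm : ¬ p ∣ d * m₀ := fun h => (hp.dvd_mul.mp h).elim hpd hpm
    have hwt : Finsupp.weight ![q, r₂, r₁] (Finsupp.single 0 (d * m₀)) < N := by
      rw [weight_single_zero, ← hN₂]
      nlinarith
    have hz : coeff (Finsupp.single 0 (d * m₀)) (y ^ p + C Λ * v ^ d + X 0 ^ M) = 0 :=
      coeff_eq_zero_of_lt_weightedOrder _ (lt_of_lt_of_le (by exact_mod_cast hwt) hreach)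
    rw [map_add, map_add, coeff_pow_expChar_eq_zero p y (i := 0) (by rwa [Finsupp.single_eq_same]), zero_add,
      coeff_C_mul, coeff_X_pow, if_neg, add_zero] at hz
    · exact (mul_ne_zero hΛ (coeff_single_pow_ne_zero hcm hini (by omega))) hz
    · intro h
      have hM : d * m₀ = M := Finsupp.single_injective 0 h
      rw [weight_single_zero, hM, mul_comm, hN₃] at hwt
      exact lt_irrefl _ hwt

/-! ## The statement in res-D-brk-1's two-flag vocabulary -/

/-- **ROW A DOMINANCE** [OURS · L1 W4.3 · (F-3d)].  For a field `K` of characteristic `p`, the germ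
`f = y^p + Λ v^d + X₀^M ∈ K⟦X₀, X₁, X₂⟧` (`p ∤ d`, `p < d`, `Λ ≠ 0`, `N = p r₁ = d r₂ = M q`, `0 < q < r₂`)
written in ANY regular system of parameters `(X₀, v, y)` sharing `X₀`: if `f` reaches level `N` in the
two-flag filtration of the coordinate flag `(X₂; X₁)` with triple `(q; r₁, r₂)`, then `v` lies in that
filtration at level `r₂` (the competing flag weighs `v` at least `r₂/q`). -/
theorem rowA_secondMember_mem (p : ℕ) [Fact p.Prime] {K : Type*} [Field K] [CharP K p]
    (d M q r₁ r₂ N : ℕ) (hpd : ¬ p ∣ d) (hlt : p < d) (hN₁ : p * r₁ = N) (hN₂ : d * r₂ = N) (hN₃ : M * q = N)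
    (hq : 0 < q) (hqr : q < r₂) (Λ : K) (hΛ : Λ ≠ 0) (y v : MvPowerSeries (Fin 3) K)
    (hframe : Ideal.span {(X 0 : MvPowerSeries (Fin 3) K), v, y} = maximalIdeal (MvPowerSeries (Fin 3) K))
    (hreach : y ^ p + C Λ * v ^ d + X 0 ^ M ∈
      flagContactFiltration (X 2 : MvPowerSeries (Fin 3) K) (X 1) q r₁ r₂ N) :
    v ∈ flagContactFiltration (X 2 : MvPowerSeries (Fin 3) K) (X 1) q r₁ r₂ r₂ := by
  have hp : p.Prime := Fact.out
  have hr₂ : 0 < r₂ := by omega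
  have hr₂r₁ : r₂ ≤ r₁ := by
    by_contra h
    push Not at h
    have h1 : p * r₁ < p * r₂ := Nat.mul_lt_mul_of_pos_left h hp.pos
    have h2 : p * r₂ < d * r₂ := Nat.mul_lt_mul_of_pos_right hlt hr₂
    omega
  have hadm : AdmissibleTriple q r₁ r₂ := ⟨hq, hqr.le, hr₂r₁⟩
  have hv𝔪 : v ∈ maximalIdeal (MvPowerSeries (Fin 3) K) := by
    rw [← hframe]; exact Ideal.subset_span (by simp)
  have hy𝔪 : y ∈ maximalIdeal (MvPowerSeries (Fin 3) K) := by
    rw [← hframe]; exact Ideal.subset_span (by simp)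
  have hX1 : (X 1 : MvPowerSeries (Fin 3) K) ∈ Ideal.span {(X 0 : MvPowerSeries (Fin 3) K), v, y} := by
    rw [hframe]; exact mem_maximalIdeal_of_constantCoeff_eq_zero (constantCoeff_X 1)
  rw [mem_flagContactFiltration_X_iff hadm] at hreach ⊢
  exact rowA_core p hpd hlt hN₁ hN₂ hN₃ hq hqr hΛ (constantCoeff_eq_zero_of_mem_maximalIdeal hv𝔪)
    (constantCoeff_eq_zero_of_mem_maximalIdeal hy𝔪) hX1 hreach

end Summit.ResolutionOfSingularities.ResolutionOfSingularities.Theorems.LocalEngine.Iota3.RowA
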